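import Mathlib
import Summits.NavierStokesRegularity.NavierStokesRegularity.Theorems.EulerZoomLiouvillePowerGaugeEulerLiouvilleClockTransferTranslate
import Summits.NavierStokesRegularity.NavierStokesRegularity.Theorems.EulerZoomLiouvillePowerGaugeEulerLiouvilleClockTransferAntitone
import Summits.NavierStokesRegularity.NavierStokesRegularity.Theorems.EulerZoomLiouvillePowerGaugeEulerLiouvilleSelfSimilarPastProfileGradient
import Summits.NavierStokesRegularity.NavierStokesRegularity.Theorems.EulerZoomLiouvillePowerGaugeEulerLiouvilleClockTransfer
import HarnessLib

/-!
# CENTRE TRANSFER, LOCAL FORM: a `T₁ = T` clock member that is LOCALLY of class `ρ′` AT ITS OWN COLLAPSE POINT is, recentred, GLOBALLY of class `ρ′`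
# (crux `EulerZoomLiouville.PowerGaugeEulerLiouville` = stmt-NavierStokesRegularity-19832; line `logtime-breathers`, residue T4 «window clocks», WEAK profiles)

Route `EulerZoomLiouville` (NavierStokesRegularity); width seat ns-ezl-w6 g2 (LEAD ns-typeII-p2 g12).  `…ClockTransfer` (p640181) needs `W ∈ C²` only for the SMALL
scales at the new centre.  Here the small scales are a HYPOTHESIS ON THE MEMBER: the class-`ρ′` gauges CENTRED AT THE COLLAPSE POINT `(T, x₀)`,
`a^{2ρ′}A(a;(T,x₀);u) + a^{ρ′}E(a;(T,x₀);H) + a^{2ρ′}D(a;(T,x₀);p)`, are bounded by `C` for `0 < a ≤ a₀` («the member is locally of Seregin's class `ρ′` at its own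
singular point»); the LARGE scales are then free by `…ClockTransferAntitone` (the gauges of an exactly self-similar triple are non-increasing in the scale).
`ClockTransfer.exists_inClass_translate_of_local`: suitable weak pair + weak gradient on the slab (NO gauge at the original origin), velocity AND pressure an exact power
clock of rate `1/(2+ρ′)` about `(T, x₀)` for all `τ < T`, `T ≤ 0`, `ρ′ ≥ 0`, ANY profiles `(W, Q)`, local bound as above ⇒ `(stPull 1 1 T x₀ u, p, H)` is an
`InClass ρ′` member with the SAME constant `C`, exactly self-similar about the origin; `ae_eq_zero_of_originAnalysis_local` is the by-name interface (ρ₀-class hypotheses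
only for the back-transfer).  Tools: `cknA/E/D_translate` (the gauges of the translate at the origin are the gauges of the member at `(T, x₀)`), `cknA/cknD_congr_of_eqOn`.
The transfer holds EXACTLY when the member is locally class-`ρ′` at its collapse point (necessity is trivial); `C²` profiles are the case where this is automatic.
WHAT THIS IS NOT: not NS, not E — MODEL-lattice reduction (`--supports` stmt-19832); kills nothing by itself; 19832 OPEN. [folklore]
-/

noncomputable section

-- flat `Theorems/<Route><Decl>…` files of one crux share the namespace of the crux (tree convention: `Summit.<S>.<S>.…`)
set_option linter.dupNamespace false

open MeasureTheory Set Filter Topology Metric Function TopologicalSpace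
open scoped ENNReal NNReal

namespace Summit.NavierStokesRegularity.NavierStokesRegularity.Theorems.PowerGaugeEulerLiouville

open Literature.Analysis Literature.Analysis.FunctionSpaces Literature.Analysis.FluidPDE

namespace ClockTransfer

variable {T : ℝ} {x₀ : EuclideanSpace ℝ (Fin 3)}
  {u : ℝ → EuclideanSpace ℝ (Fin 3) → EuclideanSpace ℝ (Fin 3)} {p : ℝ → EuclideanSpace ℝ (Fin 3) → ℝ}
  {H : ℝ → EuclideanSpace ℝ (Fin 3) → EuclideanSpace ℝ (Fin 3) →L[ℝ] EuclideanSpace ℝ (Fin 3)}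

/-! ### The gauges of the translate at the origin are the gauges of the member at `(T, x₀)` -/

/-- The translation pulls `Q_a(T, x₀)` back to `Q_a(0, 0)`. [folklore] -/
theorem preimage_parabolicCylinder_translate (a T : ℝ) (x₀ : EuclideanSpace ℝ (Fin 3)) :
    stAffine 1 1 T x₀ ⁻¹' parabolicCylinder a ((T, x₀) : ℝ × EuclideanSpace ℝ (Fin 3)) =
      parabolicCylinder a (0 : ℝ × EuclideanSpace ℝ (Fin 3)) := by
  ext ⟨s, y⟩
  simp only [mem_preimage, stAffine_apply, mem_parabolicCylinder, Prod.fst_zero, Prod.snd_zero, one_mul, one_smul,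
    dist_eq_norm, add_sub_cancel_left, sub_zero, zero_sub]
  constructor
  · rintro ⟨⟨h1, h2⟩, h3⟩; exact ⟨⟨by linarith, by linarith⟩, h3⟩
  · rintro ⟨⟨h1, h2⟩, h3⟩; exact ⟨⟨by linarith, by linarith⟩, h3⟩

/-- `E(a; 0; H ∘ τ) = E(a; (T,x₀); H)`. [folklore] -/
theorem cknE_translate (a T : ℝ) (x₀ : EuclideanSpace ℝ (Fin 3))
    (H : ℝ → EuclideanSpace ℝ (Fin 3) → EuclideanSpace ℝ (Fin 3) →L[ℝ] EuclideanSpace ℝ (Fin 3)) :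
    cknE a (0 : ℝ × EuclideanSpace ℝ (Fin 3)) (stPull 1 1 T x₀ H) = cknE a ((T, x₀) : ℝ × EuclideanSpace ℝ (Fin 3)) H := by
  have h1 := setLIntegral_frobeniusNormSq_stRescale (E := EuclideanSpace ℝ (Fin 3)) one_pos one_pos T x₀ 1 H
    (parabolicCylinder a ((T, x₀) : ℝ × EuclideanSpace ℝ (Fin 3)))
  rw [preimage_parabolicCylinder_translate, one_smul, one_pow, finrank_euclideanSpace_fin, one_pow, mul_one,
    inv_one, ENNReal.ofReal_one, one_mul, one_mul] at h1
  unfold cknE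
  rw [h1]

/-- `D(a; 0; p ∘ τ) = D(a; (T,x₀); p)`. [folklore] -/
theorem cknD_translate (a T : ℝ) (x₀ : EuclideanSpace ℝ (Fin 3)) (p : ℝ → EuclideanSpace ℝ (Fin 3) → ℝ) :
    cknD a (0 : ℝ × EuclideanSpace ℝ (Fin 3)) (stPull 1 1 T x₀ p) = cknD a ((T, x₀) : ℝ × EuclideanSpace ℝ (Fin 3)) p := by
  have h1 := setLIntegral_enorm_rpow_stRescale (E := EuclideanSpace ℝ (Fin 3)) one_pos one_pos T x₀ 1 p
    (parabolicCylinder a ((T, x₀) : ℝ × EuclideanSpace ℝ (Fin 3))) (r := 3 / 2) (by norm_num)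
  rw [preimage_parabolicCylinder_translate, one_smul, finrank_euclideanSpace_fin, one_pow, mul_one, inv_one,
    ENNReal.ofReal_one, enorm_one, ENNReal.one_rpow, one_mul, one_mul] at h1
  unfold cknD
  rw [h1]

/-- `A(a; 0; u ∘ τ) = A(a; (T,x₀); u)`. [folklore] -/
theorem cknA_translate (a T : ℝ) (x₀ : EuclideanSpace ℝ (Fin 3)) (u : ℝ → EuclideanSpace ℝ (Fin 3) → EuclideanSpace ℝ (Fin 3)) :
    cknA a (0 : ℝ × EuclideanSpace ℝ (Fin 3)) (stPull 1 1 T x₀ u) = cknA a ((T, x₀) : ℝ × EuclideanSpace ℝ (Fin 3)) u := by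
  -- slices: `∫_{B_a(0)} ‖u(T+t, x₀+y)‖² dy = ∫_{B_a(x₀)} ‖u(T+t)‖²`
  have hpre : (fun y : EuclideanSpace ℝ (Fin 3) => x₀ + (1 : ℝ) • y) ⁻¹' ball x₀ a = ball 0 a := by
    rw [space_affine_preimage_ball one_pos]; simp
  have hslice : ∀ t : ℝ, ∫⁻ x in ball (0 : EuclideanSpace ℝ (Fin 3)) a, ‖stPull 1 1 T x₀ u t x‖ₑ ^ 2 =
      ∫⁻ x in ball x₀ a, ‖u (T + t) x‖ₑ ^ 2 := by
    intro t
    have e : (fun x : EuclideanSpace ℝ (Fin 3) => ‖stPull 1 1 T x₀ u t x‖ₑ ^ 2) =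
        fun y => (fun x => ‖u (T + t) x‖ₑ ^ 2) (x₀ + (1 : ℝ) • y) := by
      funext y; simp only [stPull_apply, one_mul]
    rw [e, ← hpre, setLIntegral_preimage_comp_space_affine one_pos x₀ (fun x => ‖u (T + t) x‖ₑ ^ 2) (ball x₀ a),
      finrank_euclideanSpace_fin, one_pow, inv_one, ENNReal.ofReal_one, one_mul]
  unfold cknA
  simp only [Prod.fst_zero, Prod.snd_zero, zero_sub]
  simp_rw [hslice]
  -- reindex the supremum `t ↦ T + t`
  apply le_antisymm
  · refine iSup₂_le fun t ht => ?_
    have hτ : T + t ∈ Ioo (T - a ^ 2) T := ⟨by linarith [ht.1], by linarith [ht.2]⟩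
    exact le_iSup₂ (f := fun s (_ : s ∈ Ioo (T - a ^ 2) T) => (ENNReal.ofReal a)⁻¹ * ∫⁻ x in ball x₀ a, ‖u s x‖ₑ ^ 2)
      (T + t) hτ
  · refine iSup₂_le fun s hs => ?_
    have ht : s - T ∈ Ioo (-a ^ 2) 0 := ⟨by linarith [hs.1], by linarith [hs.2]⟩
    have e : s = T + (s - T) := by ring
    calc (ENNReal.ofReal a)⁻¹ * ∫⁻ x in ball x₀ a, ‖u s x‖ₑ ^ 2
        = (ENNReal.ofReal a)⁻¹ * ∫⁻ x in ball x₀ a, ‖u (T + (s - T)) x‖ₑ ^ 2 := by rw [← e]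
      _ ≤ _ := le_iSup₂ (f := fun t (_ : t ∈ Ioo (-a ^ 2) (0 : ℝ)) =>
          (ENNReal.ofReal a)⁻¹ * ∫⁻ x in ball x₀ a, ‖u (T + t) x‖ₑ ^ 2) (s - T) ht

/-- `cknA a 0` only sees the slices at negative times. [folklore] -/
theorem cknA_congr_of_eqOn {v w : ℝ → EuclideanSpace ℝ (Fin 3) → EuclideanSpace ℝ (Fin 3)} (h : ∀ τ : ℝ, τ < 0 → v τ = w τ) (a : ℝ) :
    cknA a (0 : ℝ × EuclideanSpace ℝ (Fin 3)) v = cknA a (0 : ℝ × EuclideanSpace ℝ (Fin 3)) w := by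
  unfold cknA
  refine iSup_congr fun t => iSup_congr fun ht => ?_
  have ht0 : t < 0 := by simpa using ht.2
  rw [h t ht0]

/-- `cknD a 0` only sees the values at negative times. [folklore] -/
theorem cknD_congr_of_eqOn {q r : ℝ → EuclideanSpace ℝ (Fin 3) → ℝ} (h : ∀ τ : ℝ, τ < 0 → q τ = r τ) (a : ℝ) :
    cknD a (0 : ℝ × EuclideanSpace ℝ (Fin 3)) q = cknD a (0 : ℝ × EuclideanSpace ℝ (Fin 3)) r := by
  unfold cknD
  congr 1
  refine setLIntegral_congr_fun (isOpen_parabolicCylinder _ _).measurableSet fun z hz => ?_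
  rw [mem_parabolicCylinder] at hz
  have ht0 : z.1 < 0 := by simpa using hz.1.2
  rw [h z.1 ht0]

/-! ### The local transfer -/

/-- **CENTRE TRANSFER, LOCAL FORM.**  Let `(u, p)` be a suitable weak Euler pair on `(−∞,0) × ℝ³` with weak gradient `H`, whose velocity and pressure are an exact
power clock of rate `1/(2+ρ)` (`ρ ≥ 0`) about `(T, x₀)`, `T ≤ 0`, for ALL `τ < T`, with ANY profiles `W`, `Q`; suppose the class-`ρ` gauge sum CENTRED AT `(T, x₀)`
is `≤ C` for every `0 < a ≤ a₀`.  Then the translate `(stPull 1 1 T x₀ u, p, H)` is a suitable weak pair with weak gradient on the slab, exactly self-similar about the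
origin, and its class-`ρ` gauge sum at the origin is `≤ C` for EVERY `a > 0`. [folklore] -/
theorem exists_inClass_translate_of_local {ρ : ℝ} (hρ : 0 ≤ ρ)
    (hsw : IsSuitableWeakSolutionOn (slab (EuclideanSpace ℝ (Fin 3)) (Iio 0) isOpen_Iio) 0 0 u p)
    (hH : HasWeakSpatialGradientOn (slab (EuclideanSpace ℝ (Fin 3)) (Iio 0) isOpen_Iio) u H)
    (hT : T ≤ 0) (x₀ : EuclideanSpace ℝ (Fin 3)) {W : EuclideanSpace ℝ (Fin 3) → EuclideanSpace ℝ (Fin 3)} {Q : EuclideanSpace ℝ (Fin 3) → ℝ}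
    (hu : ∀ τ : ℝ, τ < T → u τ = fun x => selfSimilarCollapse (1 / (2 + ρ)) T W τ (x - x₀))
    (hp : ∀ τ : ℝ, τ < T → p τ = fun x => selfSimilarCollapsePressure (1 / (2 + ρ)) T Q τ (x - x₀))
    {a₀ : ℝ} (ha₀ : 0 < a₀) {C : ℝ≥0}
    (hloc : ∀ a : ℝ, 0 < a → a ≤ a₀ →
      ENNReal.ofReal (a ^ (2 * ρ)) * cknA a ((T, x₀) : ℝ × EuclideanSpace ℝ (Fin 3)) u +
          ENNReal.ofReal (a ^ ρ) * cknE a ((T, x₀) : ℝ × EuclideanSpace ℝ (Fin 3)) H +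
        ENNReal.ofReal (a ^ (2 * ρ)) * cknD a ((T, x₀) : ℝ × EuclideanSpace ℝ (Fin 3)) p ≤ (C : ℝ≥0∞)) :
    (IsSuitableWeakSolutionOn (slab (EuclideanSpace ℝ (Fin 3)) (Iio 0) isOpen_Iio) 0 0 (stPull 1 1 T x₀ u) (stPull 1 1 T x₀ p) ∧
        HasWeakSpatialGradientOn (slab (EuclideanSpace ℝ (Fin 3)) (Iio 0) isOpen_Iio) (stPull 1 1 T x₀ u) (stPull 1 1 T x₀ H) ∧
        ∀ a : ℝ, 0 < a →
          ENNReal.ofReal (a ^ (2 * ρ)) * cknA a (0 : ℝ × EuclideanSpace ℝ (Fin 3)) (stPull 1 1 T x₀ u) +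
              ENNReal.ofReal (a ^ ρ) * cknE a (0 : ℝ × EuclideanSpace ℝ (Fin 3)) (stPull 1 1 T x₀ H) +
            ENNReal.ofReal (a ^ (2 * ρ)) * cknD a (0 : ℝ × EuclideanSpace ℝ (Fin 3)) (stPull 1 1 T x₀ p) ≤ (C : ℝ≥0∞)) ∧
      (∀ τ : ℝ, τ < 0 → stPull 1 1 T x₀ u τ = selfSimilarCollapse (1 / (2 + ρ)) 0 W τ) ∧
      (∀ τ : ℝ, τ < 0 → stPull 1 1 T x₀ p τ = selfSimilarCollapsePressure (1 / (2 + ρ)) 0 Q τ) := by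
  set γ : ℝ := 1 / (2 + ρ) with hγ
  have hsw' := isSuitableWeakSolutionOn_translate hsw hT x₀
  have hH' := hasWeakSpatialGradientOn_translate hH hT x₀
  have hu' : ∀ τ : ℝ, τ < 0 → stPull 1 1 T x₀ u τ = selfSimilarCollapse γ 0 W τ := translate_velocity_eq hu
  have hp' : ∀ τ : ℝ, τ < 0 → stPull 1 1 T x₀ p τ = selfSimilarCollapsePressure γ 0 Q τ := translate_pressure_eq hp
  refine ⟨⟨hsw', hH', fun a ha => ?_⟩, hu', hp'⟩
  -- the weak gradient of the translate is a.e. a self-similar gradient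
  obtain ⟨G, hGm, -, hae⟩ := exists_profileGradient_ae hH' hu'
  set K : ℝ → EuclideanSpace ℝ (Fin 3) → EuclideanSpace ℝ (Fin 3) →L[ℝ] EuclideanSpace ℝ (Fin 3) :=
    fun τ x => (-τ) ^ (-1 : ℝ) • G ((-τ) ^ (-γ) • x) with hKdef
  have hKpt : ∀ τ : ℝ, τ < 0 → K τ = fun x => (-τ) ^ (-1 : ℝ) • G ((-τ) ^ (-(1 / (2 + ρ))) • x) := fun _ _ => rfl
  have hHm' : AEStronglyMeasurable (uncurry (stPull 1 1 T x₀ H))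
      (((volume : Measure ℝ).restrict (Iio (0 : ℝ))).prod (volume : Measure (EuclideanSpace ℝ (Fin 3)))) := by
    have := hH'.locallyIntegrableOn_grad.aestronglyMeasurable
    rw [coe_slab, Measure.volume_eq_prod, ← Measure.prod_restrict, Measure.restrict_univ] at this
    exact this
  have hKm : AEStronglyMeasurable (uncurry K)
      (((volume : Measure ℝ).restrict (Iio (0 : ℝ))).prod (volume : Measure (EuclideanSpace ℝ (Fin 3)))) := by
    have h1 := Past.aestronglyMeasurable_uncurry_selfSimilarGradient γ (T := 0) (T₁ := 0) le_rfl (0 : EuclideanSpace ℝ (Fin 3)) hGm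
    have e : (uncurry fun (τ : ℝ) (x : EuclideanSpace ℝ (Fin 3)) => (0 - τ) ^ (-1 : ℝ) • G ((0 - τ) ^ (-γ) • (x - 0))) = uncurry K := by
      funext z; simp only [uncurry, hKdef, zero_sub, sub_zero]
    rw [e] at h1; exact h1
  have haeProd : uncurry (stPull 1 1 T x₀ H) =ᵐ[volume.restrict (Iio (0 : ℝ) ×ˢ (univ : Set (EuclideanSpace ℝ (Fin 3))))] uncurry K := by
    have := ae_eq_prod_of_ae_ae_eq hHm' hKm hae
    rw [Measure.volume_eq_prod, ← Measure.prod_restrict, Measure.restrict_univ]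
    exact this
  have hEK : ∀ b : ℝ, cknE b (0 : ℝ × EuclideanSpace ℝ (Fin 3)) (stPull 1 1 T x₀ H) = cknE b (0 : ℝ × EuclideanSpace ℝ (Fin 3)) K :=
    fun b => cknE_congr_ae_slab haeProd b 0
  -- the gauge sum of the translate, as a function of the scale, in profile form
  have hsum : ∀ b : ℝ, 0 < b →
      ENNReal.ofReal (b ^ (2 * ρ)) * cknA b (0 : ℝ × EuclideanSpace ℝ (Fin 3)) (stPull 1 1 T x₀ u) +
          ENNReal.ofReal (b ^ ρ) * cknE b (0 : ℝ × EuclideanSpace ℝ (Fin 3)) (stPull 1 1 T x₀ H) +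
        ENNReal.ofReal (b ^ (2 * ρ)) * cknD b (0 : ℝ × EuclideanSpace ℝ (Fin 3)) (stPull 1 1 T x₀ p) =
      ENNReal.ofReal (b ^ (2 * ρ)) * cknA b (0 : ℝ × EuclideanSpace ℝ (Fin 3)) (selfSimilarCollapse γ 0 W) +
          ENNReal.ofReal (b ^ ρ) * cknE b (0 : ℝ × EuclideanSpace ℝ (Fin 3)) K +
        ENNReal.ofReal (b ^ (2 * ρ)) * cknD b (0 : ℝ × EuclideanSpace ℝ (Fin 3)) (selfSimilarCollapsePressure γ 0 Q) := by
    intro b hb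
    rw [cknA_congr_of_eqOn hu' b, hEK b, cknD_congr_of_eqOn hp' b]
  -- small scales: the local bound at `(T, x₀)` transported to the origin
  have hsmall : ∀ b : ℝ, 0 < b → b ≤ a₀ →
      ENNReal.ofReal (b ^ (2 * ρ)) * cknA b (0 : ℝ × EuclideanSpace ℝ (Fin 3)) (stPull 1 1 T x₀ u) +
          ENNReal.ofReal (b ^ ρ) * cknE b (0 : ℝ × EuclideanSpace ℝ (Fin 3)) (stPull 1 1 T x₀ H) +
        ENNReal.ofReal (b ^ (2 * ρ)) * cknD b (0 : ℝ × EuclideanSpace ℝ (Fin 3)) (stPull 1 1 T x₀ p) ≤ (C : ℝ≥0∞) := by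
    intro b hb hba
    rw [cknA_translate, cknE_translate, cknD_translate]
    exact hloc b hb hba
  by_cases hle : a ≤ a₀
  · exact hsmall a ha hle
  · -- large scales: antitone gauges of the exactly self-similar triple
    have ha₀a : a₀ ≤ a := (not_le.1 hle).le
    have h0 := hsmall a₀ ha₀ le_rfl
    rw [hsum a₀ ha₀] at h0
    rw [hsum a ha]
    refine le_trans ?_ h0
    exact add_le_add (add_le_add (gaugeA_antitone hρ (v := selfSimilarCollapse γ 0 W) (fun _ _ => rfl) ha₀ ha₀a)
      (gaugeE_antitone hρ hKpt ha₀ ha₀a)) (gaugeD_antitone hρ (q := selfSimilarCollapsePressure γ 0 Q) (fun _ _ => rfl) ha₀ ha₀a)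

/-! ### Triviality transfers back — weak profiles -/

/-- If an exactly self-similar field about the origin vanishes a.e. on the slab, its profile vanishes a.e. (no continuity). [folklore] -/
theorem profile_ae_eq_zero_of_ae_eq_zero {γ : ℝ} {v : ℝ → EuclideanSpace ℝ (Fin 3) → EuclideanSpace ℝ (Fin 3)}
    {W : EuclideanSpace ℝ (Fin 3) → EuclideanSpace ℝ (Fin 3)}
    (hv : ∀ τ : ℝ, τ < 0 → v τ = selfSimilarCollapse γ 0 W τ)
    (h0 : uncurry v =ᵐ[volume.restrict (Iio (0 : ℝ) ×ˢ (univ : Set (EuclideanSpace ℝ (Fin 3))))] 0) :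
    W =ᵐ[volume] 0 := by
  rw [Measure.volume_eq_prod, ← Measure.prod_restrict, Measure.restrict_univ] at h0
  have h1 := Measure.ae_ae_of_ae_prod h0
  have h2 : ∀ᵐ τ ∂((volume : Measure ℝ).restrict (Iio (0 : ℝ))), τ < 0 := ae_restrict_mem measurableSet_Iio
  haveI : (ae ((volume : Measure ℝ).restrict (Iio (0 : ℝ)))).NeBot := by
    rw [ae_neBot, Ne, Measure.restrict_eq_zero]; simp
  obtain ⟨τ, hτ, hτ0⟩ := (h1.and h2).exists
  have hs : 0 < -τ := neg_pos.2 hτ0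
  set d : ℝ := (-τ) ^ (-γ) with hd
  have hd0 : d ≠ 0 := (Real.rpow_pos_of_pos hs _).ne'
  have hc0 : (-τ) ^ (γ - 1) ≠ 0 := (Real.rpow_pos_of_pos hs _).ne'
  have h3 : ∀ᵐ x ∂(volume : Measure (EuclideanSpace ℝ (Fin 3))), W (d • x) = 0 := by
    filter_upwards [hτ] with x hx
    have hx' : v τ x = 0 := hx
    rw [hv τ hτ0, selfSimilarCollapse_apply, zero_sub, smul_eq_zero] at hx'
    exact hx'.resolve_left hc0
  have := (quasiMeasurePreserving_smul (inv_ne_zero hd0)).ae_eq_comp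
    (show (fun x : EuclideanSpace ℝ (Fin 3) => W (d • x)) =ᵐ[volume] fun _ => (0 : EuclideanSpace ℝ (Fin 3)) from h3)
  filter_upwards [this] with y hy
  simpa [smul_smul, mul_inv_cancel₀ hd0] using hy

/-- **TRIVIALITY TRANSFERS BACK, WEAK PROFILES** (crux hypotheses verbatim, `ρ₀ ≥ 0`; any rate, ANY profile): if the translate of a `T₁ = T` power clock
vanishes a.e. on the slab then `W = 0` a.e., every slice `τ < T` of the member vanishes a.e., the past is quiescent, and the member vanishes on the WHOLE slab
(`ae_eq_zero_of_gauge_of_energyVanishing_allRho` = the filled stub `stub_quiescentPast`). [folklore] -/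
theorem ae_eq_zero_of_translate_ae_eq_zero_weak {ρ₀ γ : ℝ} (hρ₀ : 0 ≤ ρ₀) {c : ℝ≥0}
    (hsw : IsSuitableWeakSolutionOn (slab (EuclideanSpace ℝ (Fin 3)) (Iio 0) isOpen_Iio) 0 0 u p)
    (hH : HasWeakSpatialGradientOn (slab (EuclideanSpace ℝ (Fin 3)) (Iio 0) isOpen_Iio) u H)
    (hgauge : ∀ a : ℝ, 0 < a →
      ENNReal.ofReal (a ^ (2 * ρ₀)) * cknA a (0 : ℝ × EuclideanSpace ℝ (Fin 3)) u +
          ENNReal.ofReal (a ^ ρ₀) * cknE a (0 : ℝ × EuclideanSpace ℝ (Fin 3)) H +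
        ENNReal.ofReal (a ^ (2 * ρ₀)) * cknD a (0 : ℝ × EuclideanSpace ℝ (Fin 3)) p ≤ (c : ℝ≥0∞))
    {W : EuclideanSpace ℝ (Fin 3) → EuclideanSpace ℝ (Fin 3)}
    (hu : ∀ τ : ℝ, τ < T → u τ = fun x => selfSimilarCollapse γ T W τ (x - x₀))
    (h0 : uncurry (stPull 1 1 T x₀ u) =ᵐ[volume.restrict (Iio (0 : ℝ) ×ˢ (univ : Set (EuclideanSpace ℝ (Fin 3))))] 0) :
    uncurry u =ᵐ[volume.restrict (Iio (0 : ℝ) ×ˢ (univ : Set (EuclideanSpace ℝ (Fin 3))))] 0 := by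
  have hW0 : W =ᵐ[volume] 0 := profile_ae_eq_zero_of_ae_eq_zero (translate_velocity_eq hu) h0
  refine ae_eq_zero_of_gauge_of_energyVanishing_allRho hρ₀ hsw hH hgauge fun ε hε N => ?_
  -- every slice `s < T` vanishes a.e.
  have hslice : ∀ s : ℝ, s < T → ∫⁻ x, ‖u s x‖ₑ ^ 2 = 0 := by
    intro s hs
    have hsT : 0 < T - s := by linarith
    have hd : (T - s) ^ (-γ) ≠ 0 := (Real.rpow_pos_of_pos hsT _).ne'
    have hcomp : (fun x : EuclideanSpace ℝ (Fin 3) => W ((T - s) ^ (-γ) • (x - x₀))) =ᵐ[volume]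
        fun x => (0 : EuclideanSpace ℝ (Fin 3) → EuclideanSpace ℝ (Fin 3)) ((T - s) ^ (-γ) • (x - x₀)) :=
      (Past.quasiMeasurePreserving_smul_sub hd x₀).ae_eq_comp hW0
    have hus : (fun x => ‖u s x‖ₑ ^ 2) =ᵐ[volume] fun _ => 0 := by
      filter_upwards [hcomp] with x hx
      rw [hu s hs]
      simp only [selfSimilarCollapse_apply, Pi.zero_apply] at hx ⊢
      rw [hx, smul_zero, enorm_zero, zero_pow two_ne_zero]
    rw [lintegral_congr_ae hus, lintegral_zero]
  have hsub : Iio (min (-N) T) ⊆ {s : ℝ | s < -N ∧ ∫⁻ x, ‖u s x‖ₑ ^ 2 ≤ ENNReal.ofReal ε} := by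
    intro s hs
    rw [mem_Iio, lt_min_iff] at hs
    exact ⟨hs.1, by rw [hslice s hs.2]; exact zero_le⟩
  intro hnull
  have := measure_mono_null hsub hnull
  rw [Real.volume_Iio] at this
  exact ENNReal.top_ne_zero this

/-- **BY-NAME INTERFACE (local form).**  Crux hypotheses verbatim at exponent `ρ₀ ≥ 0` (only used to transfer triviality back); velocity/pressure an exact power
clock of rate `1/(2+ρ)` (`ρ ≥ 0`) about `(T ≤ 0, x₀)` for all `τ < T`, ANY profiles (no regularity); the class-`ρ` gauge sum CENTRED AT `(T, x₀)` bounded for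
`0 < a ≤ a₀`.  IF every class-`ρ` member exactly self-similar about the origin with profile `(W, Q)` vanishes (`hkill` = `Birth.selfSimilarBranch_of ρ`), the member
vanishes. [folklore] -/
theorem ae_eq_zero_of_originAnalysis_local {ρ₀ ρ : ℝ} (hρ₀ : 0 ≤ ρ₀) (hρ : 0 ≤ ρ) {c : ℝ≥0}
    (hsw : IsSuitableWeakSolutionOn (slab (EuclideanSpace ℝ (Fin 3)) (Iio 0) isOpen_Iio) 0 0 u p)
    (hH : HasWeakSpatialGradientOn (slab (EuclideanSpace ℝ (Fin 3)) (Iio 0) isOpen_Iio) u H)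
    (hgauge : ∀ a : ℝ, 0 < a →
      ENNReal.ofReal (a ^ (2 * ρ₀)) * cknA a (0 : ℝ × EuclideanSpace ℝ (Fin 3)) u +
          ENNReal.ofReal (a ^ ρ₀) * cknE a (0 : ℝ × EuclideanSpace ℝ (Fin 3)) H +
        ENNReal.ofReal (a ^ (2 * ρ₀)) * cknD a (0 : ℝ × EuclideanSpace ℝ (Fin 3)) p ≤ (c : ℝ≥0∞))
    (hT : T ≤ 0) (x₀ : EuclideanSpace ℝ (Fin 3)) {W : EuclideanSpace ℝ (Fin 3) → EuclideanSpace ℝ (Fin 3)} {Q : EuclideanSpace ℝ (Fin 3) → ℝ}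
    (hu : ∀ τ : ℝ, τ < T → u τ = fun x => selfSimilarCollapse (1 / (2 + ρ)) T W τ (x - x₀))
    (hp : ∀ τ : ℝ, τ < T → p τ = fun x => selfSimilarCollapsePressure (1 / (2 + ρ)) T Q τ (x - x₀))
    {a₀ : ℝ} (ha₀ : 0 < a₀) {C : ℝ≥0}
    (hloc : ∀ a : ℝ, 0 < a → a ≤ a₀ →
      ENNReal.ofReal (a ^ (2 * ρ)) * cknA a ((T, x₀) : ℝ × EuclideanSpace ℝ (Fin 3)) u +
          ENNReal.ofReal (a ^ ρ) * cknE a ((T, x₀) : ℝ × EuclideanSpace ℝ (Fin 3)) H +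
        ENNReal.ofReal (a ^ (2 * ρ)) * cknD a ((T, x₀) : ℝ × EuclideanSpace ℝ (Fin 3)) p ≤ (C : ℝ≥0∞))
    (hkill : ∀ (u' : ℝ → EuclideanSpace ℝ (Fin 3) → EuclideanSpace ℝ (Fin 3)) (p' : ℝ → EuclideanSpace ℝ (Fin 3) → ℝ)
        (H' : ℝ → EuclideanSpace ℝ (Fin 3) → EuclideanSpace ℝ (Fin 3) →L[ℝ] EuclideanSpace ℝ (Fin 3)) (c' : ℝ≥0),
      (IsSuitableWeakSolutionOn (slab (EuclideanSpace ℝ (Fin 3)) (Iio 0) isOpen_Iio) 0 0 u' p' ∧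
        HasWeakSpatialGradientOn (slab (EuclideanSpace ℝ (Fin 3)) (Iio 0) isOpen_Iio) u' H' ∧
        ∀ a : ℝ, 0 < a →
          ENNReal.ofReal (a ^ (2 * ρ)) * cknA a (0 : ℝ × EuclideanSpace ℝ (Fin 3)) u' +
              ENNReal.ofReal (a ^ ρ) * cknE a (0 : ℝ × EuclideanSpace ℝ (Fin 3)) H' +
            ENNReal.ofReal (a ^ (2 * ρ)) * cknD a (0 : ℝ × EuclideanSpace ℝ (Fin 3)) p' ≤ (c' : ℝ≥0∞)) →
      ((∀ τ : ℝ, τ < 0 → u' τ = selfSimilarCollapse (1 / (2 + ρ)) 0 W τ) ∧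
        (∀ τ : ℝ, τ < 0 → p' τ = selfSimilarCollapsePressure (1 / (2 + ρ)) 0 Q τ)) →
      uncurry u' =ᵐ[volume.restrict (Iio (0 : ℝ) ×ˢ (univ : Set (EuclideanSpace ℝ (Fin 3))))] 0) :
    uncurry u =ᵐ[volume.restrict (Iio (0 : ℝ) ×ˢ (univ : Set (EuclideanSpace ℝ (Fin 3))))] 0 := by
  obtain ⟨hcls, hu', hp'⟩ := exists_inClass_translate_of_local hρ hsw hH hT x₀ hu hp ha₀ hloc
  exact ae_eq_zero_of_translate_ae_eq_zero_weak hρ₀ hsw hH hgauge hu (hkill _ _ _ C hcls ⟨hu', hp'⟩)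

/-! ### `C²` profiles are locally of class `ρ′` at their collapse point (`IsCollapseClockC2 ⊆ IsCollapseClockLocal`) -/

/-- Two weak spatial gradients of an exactly self-similar field about the origin agree a.e. on the slab (both are a.e. the self-similar gradient of a weak
derivative of the profile, and weak derivatives are unique). [folklore] -/
theorem weakGradient_ae_eq_of_selfSimilar {γ : ℝ} {v : ℝ → EuclideanSpace ℝ (Fin 3) → EuclideanSpace ℝ (Fin 3)}
    {W : EuclideanSpace ℝ (Fin 3) → EuclideanSpace ℝ (Fin 3)}
    {H₁ H₂ : ℝ → EuclideanSpace ℝ (Fin 3) → EuclideanSpace ℝ (Fin 3) →L[ℝ] EuclideanSpace ℝ (Fin 3)}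
    (h₁ : HasWeakSpatialGradientOn (slab (EuclideanSpace ℝ (Fin 3)) (Iio 0) isOpen_Iio) v H₁)
    (h₂ : HasWeakSpatialGradientOn (slab (EuclideanSpace ℝ (Fin 3)) (Iio 0) isOpen_Iio) v H₂)
    (hv : ∀ τ : ℝ, τ < 0 → v τ = selfSimilarCollapse γ 0 W τ) :
    uncurry H₁ =ᵐ[volume.restrict (Iio (0 : ℝ) ×ˢ (univ : Set (EuclideanSpace ℝ (Fin 3))))] uncurry H₂ := by
  obtain ⟨G₁, hG₁m, hWG₁, hae₁⟩ := exists_profileGradient_ae h₁ hv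
  obtain ⟨G₂, hG₂m, hWG₂, hae₂⟩ := exists_profileGradient_ae h₂ hv
  have hGG : G₁ =ᵐ[volume] G₂ := by
    have := HasWeakFDerivOn.unique_holds hWG₁ hWG₂
    rwa [Opens.coe_top, Measure.restrict_univ] at this
  have hae : ∀ᵐ τ ∂((volume : Measure ℝ).restrict (Iio (0 : ℝ))), H₁ τ =ᵐ[volume] H₂ τ := by
    filter_upwards [hae₁, hae₂, ae_restrict_mem measurableSet_Iio] with τ h1 h2 hτ0
    have hs : 0 < -τ := neg_pos.2 hτ0
    have hd : (-τ) ^ (-γ) ≠ 0 := (Real.rpow_pos_of_pos hs _).ne'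
    have h3 : (fun x : EuclideanSpace ℝ (Fin 3) => G₁ ((-τ) ^ (-γ) • x)) =ᵐ[volume] fun x => G₂ ((-τ) ^ (-γ) • x) :=
      (quasiMeasurePreserving_smul hd).ae_eq_comp hGG
    filter_upwards [h1, h2, h3] with x hx1 hx2 hx3
    rw [hx1, hx2]
    exact congrArg (fun w => (-τ) ^ (-1 : ℝ) • w) hx3
  have hm : ∀ {K : ℝ → EuclideanSpace ℝ (Fin 3) → EuclideanSpace ℝ (Fin 3) →L[ℝ] EuclideanSpace ℝ (Fin 3)},
      HasWeakSpatialGradientOn (slab (EuclideanSpace ℝ (Fin 3)) (Iio 0) isOpen_Iio) v K →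
      AEStronglyMeasurable (uncurry K) (((volume : Measure ℝ).restrict (Iio (0 : ℝ))).prod (volume : Measure (EuclideanSpace ℝ (Fin 3)))) := by
    intro K hK
    have := hK.locallyIntegrableOn_grad.aestronglyMeasurable
    rw [coe_slab, Measure.volume_eq_prod, ← Measure.prod_restrict, Measure.restrict_univ] at this
    exact this
  have := ae_eq_prod_of_ae_ae_eq (hm h₁) (hm h₂) hae
  rw [Measure.volume_eq_prod, ← Measure.prod_restrict, Measure.restrict_univ]
  exact this

/-- **THE TRANSLATE OF A `C²` COLLAPSE CLOCK IS ITSELF IN CLASS `ρ′`** (with its own translated pressure and weak gradient): repackaging of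
`exists_inClass_selfSimilarCollapse` (p640181) — the ansatz member's gauges are the translate's gauges (`cknA/cknD_congr_of_eqOn`, uniqueness of the weak
gradient).  Consequently a `C²` clock member is LOCALLY of class `ρ′` at its collapse point (`cknA/E/D_translate`): `IsCollapseClockC2 ⊆ IsCollapseClockLocal`. [folklore] -/
theorem exists_inClass_translate_of_C2 {ρ₀ ρ : ℝ} (hρ : -1 / 2 < ρ) (hρ1 : ρ < 1) {c : ℝ≥0}
    (hsw : IsSuitableWeakSolutionOn (slab (EuclideanSpace ℝ (Fin 3)) (Iio 0) isOpen_Iio) 0 0 u p)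
    (hH : HasWeakSpatialGradientOn (slab (EuclideanSpace ℝ (Fin 3)) (Iio 0) isOpen_Iio) u H)
    (hgauge : ∀ a : ℝ, 0 < a →
      ENNReal.ofReal (a ^ (2 * ρ₀)) * cknA a (0 : ℝ × EuclideanSpace ℝ (Fin 3)) u +
          ENNReal.ofReal (a ^ ρ₀) * cknE a (0 : ℝ × EuclideanSpace ℝ (Fin 3)) H +
        ENNReal.ofReal (a ^ (2 * ρ₀)) * cknD a (0 : ℝ × EuclideanSpace ℝ (Fin 3)) p ≤ (c : ℝ≥0∞))
    (hT : T ≤ 0) (x₀ : EuclideanSpace ℝ (Fin 3)) {W : EuclideanSpace ℝ (Fin 3) → EuclideanSpace ℝ (Fin 3)} {Q : EuclideanSpace ℝ (Fin 3) → ℝ}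
    (hu : ∀ τ : ℝ, τ < T → u τ = fun x => selfSimilarCollapse (1 / (2 + ρ)) T W τ (x - x₀))
    (hp : ∀ τ : ℝ, τ < T → p τ = fun x => selfSimilarCollapsePressure (1 / (2 + ρ)) T Q τ (x - x₀))
    (hW : ContDiff ℝ 2 W) :
    ∃ c' : ℝ≥0, ∀ a : ℝ, 0 < a →
      ENNReal.ofReal (a ^ (2 * ρ)) * cknA a ((T, x₀) : ℝ × EuclideanSpace ℝ (Fin 3)) u +
          ENNReal.ofReal (a ^ ρ) * cknE a ((T, x₀) : ℝ × EuclideanSpace ℝ (Fin 3)) H +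
        ENNReal.ofReal (a ^ (2 * ρ)) * cknD a ((T, x₀) : ℝ × EuclideanSpace ℝ (Fin 3)) p ≤ (c' : ℝ≥0∞) := by
  obtain ⟨H'', c', hsw'', hH'', hg''⟩ := exists_inClass_selfSimilarCollapse hρ hρ1 hsw hH hgauge hT x₀ hu hp hW
  have hu' := translate_velocity_eq hu
  have hp' := translate_pressure_eq hp
  have hH' := hasWeakSpatialGradientOn_translate hH hT x₀
  -- `stPull H` is a weak gradient of the ansatz too (the translate agrees with the ansatz on the slab)
  have hSm : MeasurableSet (((slab (EuclideanSpace ℝ (Fin 3)) (Iio 0) isOpen_Iio : Opens (ℝ × EuclideanSpace ℝ (Fin 3))) :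
      Set (ℝ × EuclideanSpace ℝ (Fin 3)))) :=
    (slab (EuclideanSpace ℝ (Fin 3)) (Iio 0) isOpen_Iio).2.measurableSet
  have huae : ∀ᵐ z ∂(volume.restrict (((slab (EuclideanSpace ℝ (Fin 3)) (Iio 0) isOpen_Iio :
      Opens (ℝ × EuclideanSpace ℝ (Fin 3))) : Set (ℝ × EuclideanSpace ℝ (Fin 3))))),
      uncurry (stPull 1 1 T x₀ u) z = uncurry (selfSimilarCollapse (1 / (2 + ρ)) 0 W) z := by
    refine ae_restrict_of_forall_mem hSm fun z hz => ?_
    rw [SetLike.mem_coe, mem_slab, mem_Iio] at hz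
    change stPull 1 1 T x₀ u z.1 z.2 = selfSimilarCollapse (1 / (2 + ρ)) 0 W z.1 z.2
    rw [hu' z.1 hz]
  have hHt : HasWeakSpatialGradientOn (slab (EuclideanSpace ℝ (Fin 3)) (Iio 0) isOpen_Iio)
      (selfSimilarCollapse (1 / (2 + ρ)) 0 W) (stPull 1 1 T x₀ H) := hH'.congr_ae huae
  have hEE : ∀ a, cknE a (0 : ℝ × EuclideanSpace ℝ (Fin 3)) (stPull 1 1 T x₀ H) = cknE a (0 : ℝ × EuclideanSpace ℝ (Fin 3)) H'' :=
    fun a => cknE_congr_ae_slab (weakGradient_ae_eq_of_selfSimilar hHt hH'' (fun _ _ => rfl)) a 0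
  refine ⟨c', fun a ha => ?_⟩
  rw [← cknA_translate, ← cknE_translate, ← cknD_translate, cknA_congr_of_eqOn hu' a, hEE a, cknD_congr_of_eqOn hp' a]
  exact hg'' a ha

end ClockTransfer

end Summit.NavierStokesRegularity.NavierStokesRegularity.Theorems.PowerGaugeEulerLiouville
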